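import Summits.BirchSwinnertonDyer.Rank1Residual.Partition.X10CongruenceTransfer
import Literature.NumberTheory.EllipticCurves.PAdicBSDInterpolationProofs
import Literature.NumberTheory.EllipticCurves.IwasawaLeadingTermProofs
import Literature.NumberTheory.EllipticCurves.LeadingTermPPartProofs
import Literature.NumberTheory.EllipticCurves.ComplexMultiplicationBurungaleFlachProofs
import Literature.NumberTheory.EllipticCurves.RegulatorProofs
import Literature.NumberTheory.EllipticCurves.Rank1Residual.PrintShape
import HarnessLib

/-!
# Certificate C2 at `n = 0` DECIDED by the partner's table row: the constant coefficient of
# `𝓛_MSD(E₁) = ϖ₁ · L₃(f₁, α₁)` is a `3`-adic unit when the class is non-anomalous and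
# `3 ∤ #Ш_an(E₁) · ∏ c_ℓ(E₁)` (cell `bsd-litref`, `yz26`, seat `bsd-litref-yz26-pv`; companion of
# `Partition/X10CongruenceTransfer.lean`, p476288)

HONEST FRAMING (programme §HONESTY): theorems only, no new named fact; nothing moves a class. This file
discharges, for the «type A» partners of the congruence-transfer road, the `μ = 0` certificate C2 IN THE
KERNEL from the three numbers the lane already certifies per curve (`#Ẽ₁(𝔽_p)`, `#Ш_an(E₁)`,
`∏ c_ℓ(E₁)`): by the Mazur–Tate–Teitelbaum interpolation at the trivial character
(`constantCoeff_padicLFunction_unitRoot`: `L_p(E,0) = (1 - α⁻¹)² [0]⁺_f`), the bridge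
`1 - α⁻¹ = u · #Ẽ(𝔽_p)` (`exists_unit_one_sub_unitRoot_inv`), Manin–Drinfeld
(`IsNewformOf.entireLFunction_one_eq`: `L(E,1) = [0]⁺_f Ω⁺_f`), the definition of `#Ш_an`
(`shaAn_def`, rank `0`: `leadingLCoeff = L(E,1)`, `Reg = 1`), the period unit `ord_p ϖ = 0` (Mazur 1978
Cor. 4.1 through `SkinnerUrban2014.periodUnit_of_mazur`) and `p ∤ #E(ℚ)_tors` (irreducibility):
`coeff₀(ϖ · L_p(f, α)) = ϖ (1 - α⁻¹)² [0]⁺_f` has `p`-adic norm `1` iff `p ∤ #Ẽ(𝔽_p)` and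
`ord_p([0]⁺_f) = ord_p(#Ш_an) + ord_p(∏ c_ℓ) - ord_p ϖ - 2 ord_p #E(ℚ)_tors = 0`.
[cite: MazurTateTeitelbaum1986Invent, §I.14 (14.3)] [cite: GreenbergVatsal2000, Thm. (1.4) and (2)]
-/

set_option autoImplicit false

noncomputable section

open scoped Classical MatrixGroups ModularForm

open CongruenceSubgroup WeierstrassCurve Field Literature.NumberTheory.EllipticCurves
  Literature.NumberTheory.EllipticCurves.ModularForms
  Literature.NumberTheory.EllipticCurves.Rank1Residual
  Literature.NumberTheory.EllipticCurves.GreenbergVatsal2000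
  Literature.NumberTheory.EllipticCurves.Wuthrich2014
  Summit.BirchSwinnertonDyer.BirchSwinnertonDyer.Theorems.Rank1ResidualX1Defs

namespace Summit.BirchSwinnertonDyer.Rank1Residual

variable (W : WeierstrassCurve ℚ) [W.IsElliptic] [W.IsGloballyMinimal] (p : ℕ) [hp : Fact p.Prime]

omit [W.IsGloballyMinimal] in
/-- **`#Ш_an` in rank `0` against the modular symbol `[0]⁺_f`**: for the newform `f` of `E` and a
rational `ϖ` with `ϖ · Ω_E = Ω⁺_f`, if `ord_{s=1} L(E,s) = 0` then
`#Ш_an(E) = [0]⁺_f · ϖ · #E(ℚ)_tors² / ∏ c_ℓ` as rational numbers (`L(E,1) = [0]⁺_f Ω⁺_f`,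
`leadingLCoeff = L(E,1)`, `Reg(E/ℚ) = 1` in rank `0` by GZK). [folklore]
[cite: MazurTateTeitelbaum1986Invent, §I.8 (8.6)] [cite: Miller2011LMS, §1] -/
theorem shaAn_eq_ratPlusSymbol_mul_of_analyticRank_eq_zero
    (hGZK : rank_eq_analyticRank_of_analyticRank_le_one) (hr0 : W.analyticRank = 0)
    [NeZero (W.conductorNorm ℤ)] (f : CuspForm (Gamma0 (W.conductorNorm ℤ)) 2) (hf : IsNewformOf W f)
    (ϖ : ℚ) (hϖ : (ϖ : ℝ) * W.realPeriodRat = plusPeriod f) :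
    shaAn W = (((ratPlusSymbol f 0 : ℚ) * ϖ * (W.torsionOrder : ℚ) ^ 2 / (W.tamagawaProduct : ℚ) : ℚ) : ℂ) := by
  have hrank : W.mordellWeilRank = 0 := by
    have h := (hGZK W (by rw [hr0]; exact zero_le_one)).1
    rw [h, hr0]
  have hreg : W.regulator = 1 := W.regulator_eq_one_of_rank_zero hrank
  have hlead : W.leadingLCoeff = W.entireLFunction 1 := W.leadingLCoeff_eq_of_analyticRank_eq_zero hr0
  have hΩ : (W.realPeriodRat : ℂ) ≠ 0 :=
    Complex.ofReal_ne_zero.mpr (ne_of_gt (W.realPeriodRat_pos_holds : 0 < W.realPeriodRat))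
  have hc : (W.tamagawaProduct : ℂ) ≠ 0 := by
    exact_mod_cast (W.tamagawaProduct_pos_holds : 0 < W.tamagawaProduct).ne'
  rw [shaAn_def, hlead, hf.entireLFunction_one_eq, hreg, ← hϖ]
  push_cast
  field_simp

/-- **`ord_p [0]⁺_f = 0` from the table row** (rank `0`, `E[p]` irreducible at an odd good prime `p`):
if `ord_p #Ш_an(E) = 0` and `p ∤ ∏ c_ℓ(E)`, then the modular symbol `[0]⁺_f = L(E,1)/Ω⁺_f` is a
`p`-adic unit (`p ∤ #E(ℚ)_tors` by irreducibility; `ord_p ϖ = 0` by Mazur 1978 Cor. 4.1, `hM`).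
[cite: Mazur1978, Cor. 4.1] [cite: MazurTateTeitelbaum1986Invent, §I.8 (8.6)] -/
theorem padicValRat_ratPlusSymbol_zero_eq_zero (hM : mazur_not_dvd_maninConstant_of_odd)
    (hGZK : rank_eq_analyticRank_of_analyticRank_le_one) (hp2 : p ≠ 2)
    (hgood : W.HasGoodReductionAtPrime p) (hirr : W.HasIrreducibleModPGaloisRep p)
    (hr0 : W.analyticRank = 0) (hsha : ∃ q : ℚ, shaAn W = (q : ℂ) ∧ padicValRat p q = 0)
    (htam : ¬ p ∣ W.tamagawaProduct)
    [NeZero (W.conductorNorm ℤ)] (f : CuspForm (Gamma0 (W.conductorNorm ℤ)) 2) (hf : IsNewformOf W f)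
    (ϖ : ℚ) (hϖ : (ϖ : ℝ) * W.realPeriodRat = plusPeriod f) :
    ratPlusSymbol f 0 ≠ 0 ∧ padicValRat p (ratPlusSymbol f 0) = 0 := by
  obtain ⟨q, hq, hvq⟩ := hsha
  have hϖv : padicValRat p ϖ = 0 := SkinnerUrban2014.periodUnit_of_mazur hM W p hp2 hgood hirr f hf ϖ hϖ
  have hΩpos : 0 < W.realPeriodRat := W.realPeriodRat_pos_holds
  have hΩf : 0 < plusPeriod f := IsNewform0.plusPeriod_pos_holds hf.1 hf.coeffField_eq_bot
  have hϖ0 : ϖ ≠ 0 := by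
    intro h
    rw [h, Rat.cast_zero, zero_mul] at hϖ
    exact hΩf.ne' hϖ.symm
  have hT0 : (W.torsionOrder : ℚ) ≠ 0 := by exact_mod_cast (W.torsionOrder_pos_holds).ne'
  have hc0 : (W.tamagawaProduct : ℚ) ≠ 0 := by
    exact_mod_cast (W.tamagawaProduct_pos_holds : 0 < W.tamagawaProduct).ne'
  have hshaQ := shaAn_eq_ratPlusSymbol_mul_of_analyticRank_eq_zero W hGZK hr0 f hf ϖ hϖ
  rw [hq] at hshaQ
  have hqe : q = (ratPlusSymbol f 0 : ℚ) * ϖ * (W.torsionOrder : ℚ) ^ 2 / (W.tamagawaProduct : ℚ) := by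
    exact_mod_cast hshaQ
  -- `q ≠ 0`: `#Ш_an > 0` is not needed — `L(E,1) ≠ 0` gives `[0]⁺ ≠ 0`
  have hL : W.entireLFunction 1 ≠ 0 := (W.analyticRank_eq_zero_iff_holds hf.hasEntireLFunction).mp hr0
  have hs0 : (ratPlusSymbol f 0 : ℚ) ≠ 0 := by
    intro h0; apply hL; rw [hf.entireLFunction_one_eq, h0]; simp
  refine ⟨hs0, ?_⟩
  have hq0 : q ≠ 0 := by
    rw [hqe]; exact div_ne_zero (mul_ne_zero (mul_ne_zero hs0 hϖ0) (pow_ne_zero 2 hT0)) hc0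
  -- valuations: `v(q) = v(s) + v(ϖ) + 2 v(T) - v(c)`
  have hvT : padicValRat p (W.torsionOrder : ℚ) = 0 := by
    rw [padicValRat.of_nat]; exact_mod_cast padicValNat_torsionOrder_eq_zero_of_irreducible W p hirr
  have hvc : padicValRat p (W.tamagawaProduct : ℚ) = 0 := by
    rw [padicValRat.of_nat]; exact_mod_cast padicValNat.eq_zero_of_not_dvd htam
  have hv := congrArg (padicValRat p) hqe
  rw [hvq, padicValRat.div (mul_ne_zero (mul_ne_zero hs0 hϖ0) (pow_ne_zero 2 hT0)) hc0,
    padicValRat.mul (mul_ne_zero hs0 hϖ0) (pow_ne_zero 2 hT0), padicValRat.mul hs0 hϖ0,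
    padicValRat.pow (W.torsionOrder : ℚ), hϖv, hvT, hvc] at hv
  simp at hv
  linarith

/-- **Certificate C2 at `n = 0` from the table row.** At an odd good ordinary prime `p` with `E[p]`
irreducible, rank `0`, NON-ANOMALOUS (`p ∤ #Ẽ(𝔽_p)`), `ord_p #Ш_an(E) = 0` and `p ∤ ∏ c_ℓ(E)`: the
constant coefficient of `ϖ · L_p(f, α)` is a `p`-adic unit — so `∃ n, ‖coeff n (ϖ · L_p(f,α))‖ = 1`,
the `μ`-certificate binder `hμ₁` of `mazurMainConjecture_three_of_congruentPartner`, holds with `n = 0`.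
(`L_p(E,0) = (1 - α⁻¹)² [0]⁺_f`, `1 - α⁻¹ = u · #Ẽ(𝔽_p)`.)
[cite: MazurTateTeitelbaum1986Invent, §I.14 (14.3)] [cite: BalakrishnanMullerStein2015, Thm. 1.7 (remark following)] -/
theorem unitCoeff_of_shaAn_unit_of_not_anomalous (hM : mazur_not_dvd_maninConstant_of_odd)
    (hGZK : rank_eq_analyticRank_of_analyticRank_le_one) (hp2 : p ≠ 2) (hord : GoodOrd W p)
    (hirr : W.HasIrreducibleModPGaloisRep p) (hr0 : W.analyticRank = 0)
    (hna : ¬ p ∣ W.reductionPointCount p)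
    (hsha : ∃ q : ℚ, shaAn W = (q : ℂ) ∧ padicValRat p q = 0) (htam : ¬ p ∣ W.tamagawaProduct) :
    ∀ [NeZero (W.conductorNorm ℤ)] (f : CuspForm (Gamma0 (W.conductorNorm ℤ)) 2),
        IsNewformOf W f → ∀ (ϖ : ℚ), (ϖ : ℝ) * W.realPeriodRat = plusPeriod f →
      ∃ n : ℕ, ‖PowerSeries.coeff n
        (PowerSeries.C (ϖ : ℚ_[p]) * padicLFunction f (unitRoot W p : ℚ_[p]))‖ = 1 := by
  intro _ f hf ϖ hϖ
  refine ⟨0, ?_⟩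
  have hordp : IsOrdinaryAt W p := ⟨hord.1, hord.2⟩
  obtain ⟨hs0, hvs⟩ := padicValRat_ratPlusSymbol_zero_eq_zero W p hM hGZK hp2 hord.1 hirr hr0 hsha htam f hf ϖ hϖ
  have hϖv : padicValRat p ϖ = 0 := SkinnerUrban2014.periodUnit_of_mazur hM W p hp2 hord.1 hirr f hf ϖ hϖ
  have hΩf : 0 < plusPeriod f := IsNewform0.plusPeriod_pos_holds hf.1 hf.coeffField_eq_bot
  have hϖ0 : ϖ ≠ 0 := by
    intro h
    rw [h, Rat.cast_zero, zero_mul] at hϖ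
    exact hΩf.ne' hϖ.symm
  -- the constant coefficient
  rw [PowerSeries.coeff_zero_eq_constantCoeff_apply, map_mul, PowerSeries.constantCoeff_C,
    constantCoeff_padicLFunction_unitRoot hordp hf]
  obtain ⟨u, hu⟩ := exists_unit_one_sub_unitRoot_inv p W hordp
  rw [hu]
  -- norms
  have hnϖ : ‖(ϖ : ℚ_[p])‖ = 1 := by
    rw [Padic.eq_padicNorm, padicNorm.eq_zpow_of_nonzero hϖ0, hϖv, neg_zero, zpow_zero,
      Rat.cast_one]
  have hns : ‖((ratPlusSymbol f 0 : ℚ) : ℚ_[p])‖ = 1 := by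
    rw [Padic.eq_padicNorm, padicNorm.eq_zpow_of_nonzero hs0, hvs, neg_zero, zpow_zero,
      Rat.cast_one]
  have hnu : ‖((u : ℤ_[p]) : ℚ_[p])‖ = 1 := by
    rw [PadicInt.padic_norm_e_of_padicInt]
    exact PadicInt.isUnit_iff.mp (Units.isUnit u)
  have hnN : ‖(W.reductionPointCount p : ℚ_[p])‖ = 1 := by
    have hle : ‖((W.reductionPointCount p : ℤ) : ℚ_[p])‖ ≤ 1 := Padic.norm_int_le_one _
    have hnlt : ¬ ‖((W.reductionPointCount p : ℤ) : ℚ_[p])‖ < 1 := by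
      rw [Padic.norm_intCast_lt_one_iff]
      exact_mod_cast hna
    have : ((W.reductionPointCount p : ℤ) : ℚ_[p]) = (W.reductionPointCount p : ℚ_[p]) := by norm_cast
    rw [this] at hle hnlt
    exact le_antisymm hle (not_lt.mp hnlt)
  rw [norm_mul, norm_mul, norm_pow, norm_mul, hnϖ, hnu, hnN, hns]
  norm_num

/-! ### The «type A» road: every per-pair input except C1 is a table row -/

/-- **Mazur's main conjecture for `(E₂, 3)` from a TYPE-A partner — only the torsion isomorphism is a
certificate.** PARTNER `E₁` (`W₁` globally minimal): good ordinary and `ρ̄` surjective at `3`,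
`ord_{s=1} L(E₁,s) = 0`, NON-ANOMALOUS (`3 ∤ #Ẽ₁(𝔽₃)` — equivalently `a₃ ≢ 1 (mod 3)`, a property of
the whole congruence class), `ord₃ #Ш_an(E₁) = 0` (the lane's exact `#Ш_an`) and `3 ∤ ∏ c_ℓ(E₁)`:
then C2 holds at `n = 0` (`unitCoeff_of_shaAn_unit_of_not_anomalous`), `BSD(E₁,3)` holds by lever L1
(Wuthrich 2014 Prop. 21, `hW`), and `mazurMainConjecture_three_of_congruentPartner` transfers along
C1 (`hiso`). Named facts: GV (1.4), Kato 17.4 (3) for `E₁`, Greenberg 4.1, GZK, modularity (`hmodL`),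
Wuthrich L.20 / Prop. 21, Mazur 1978 Cor. 4.1. [cite: GreenbergVatsal2000, Thm. (1.4)]
[cite: Wuthrich2014, Prop. 21 and Lemma 20 (p. 400)] [cite: MazurTateTeitelbaum1986Invent, §I.14 (14.3)] -/
theorem mazurMainConjecture_three_of_typeAPartner (W₁ W₂ : WeierstrassCurve ℚ) [W₁.IsElliptic]
    [W₁.IsGloballyMinimal] [W₂.IsElliptic] [W₂.IsGloballyMinimal]
    (hGV : thm14_mainConjecture_transfer_of_torsionIso) (hGr : greenberg_charValue_rankZero)
    (hmodL : hasEntireLFunction_rat) (hGZK : rank_eq_analyticRank_of_analyticRank_le_one)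
    (hW : sha_dvd_analyticSha) (hW20 : lemma20_surjective_threeAdic_of_semistable)
    (hM : mazur_not_dvd_maninConstant_of_odd)
    (hK₁ : ∀ (κ : ZpExtension ℚ 3) (γ : Field.absoluteGaloisGroup ℚ) [NeZero (W₁.conductorNorm ℤ)]
      (f : CuspForm (Gamma0 (W₁.conductorNorm ℤ)) 2), kato_divisibility W₁ 3 (κ := κ) (γ := γ) (f := f))
    (hord₁ : GoodOrd W₁ 3) (hsurj₁ : Surj W₁ 3) (hr0₁ : W₁.analyticRank = 0)
    (hna₁ : ¬ 3 ∣ W₁.reductionPointCount 3)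
    (hsha₁ : ∃ q : ℚ, shaAn W₁ = (q : ℂ) ∧ padicValRat 3 q = 0) (htam₁ : ¬ 3 ∣ W₁.tamagawaProduct)
    (hiso : ∃ e : geomTorsion W₁ ((3 : ℕ) : ℤ) ≃+ geomTorsion W₂ ((3 : ℕ) : ℤ),
      ∀ (σ : Field.absoluteGaloisGroup ℚ) (P : geomTorsion W₁ ((3 : ℕ) : ℤ)), e (σ • P) = σ • e P)
    (hord₂ : GoodOrd W₂ 3) : MazurMainConjecture W₂ 3 := by
  have hirr₁ : W₁.HasIrreducibleModPGaloisRep 3 :=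
    hasIrreducibleModPGaloisRep_of_hasSurjectiveModNGaloisRep W₁ 3 hsurj₁
  have hL₁ : W₁.entireLFunction 1 ≠ 0 := (W₁.analyticRank_eq_zero_iff_holds (hmodL W₁)).mp hr0₁
  have hbsd₁ : BSDp W₁ 3 :=
    bsdp_of_L_one_ne_zero_of_padicValRat_shaAn_eq_zero hW hGZK W₁ 3 (by decide) hL₁
      (WeierstrassCurve.HasGoodReduction.not_hasAdditiveReduction _ hord₁.1) (Or.inr hsurj₁) hsha₁
  exact mazurMainConjecture_three_of_congruentPartner W₁ W₂ hGV hGr hGZK hW20 hM hK₁ hord₁ hsurj₁ hL₁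
    hbsd₁ (unitCoeff_of_shaAn_unit_of_not_anomalous W₁ 3 hM hGZK (by decide) hord₁ hirr₁ hr0₁ hna₁
      hsha₁ htam₁) hiso hord₂

/-- **Row C16 ∩ {r = 0} at `p = 3` from a TYPE-A partner: `BSD(E₂,3)`** with the torsion
isomorphism C1 as the ONLY certificate beyond table rows (partner: rank `0`, good ordinary + `ρ̄`
surjective at `3`, `3 ∤ #Ẽ₁(𝔽₃) · #Ш_an(E₁) · ∏ c_ℓ(E₁)`; target: RowC16, `ord_{s=1} L(E₂,s) = 0`).
No hypothesis on `#Ш_an(E₂)`, no (ram) prime, no Beilinson–Flach / Yan–Zhu input.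
[cite: GreenbergVatsal2000, Thm. (1.4)] [cite: Wuthrich2014, Prop. 21 (p. 400)]
[cite: CastellaEtAl2021, Thm. 5.1.4 (proof)] -/
theorem RowC16.bsdp_three_rankZero_of_typeAPartner (W₁ W₂ : WeierstrassCurve ℚ) [W₁.IsElliptic]
    [W₁.IsGloballyMinimal] [W₂.IsElliptic] [W₂.IsGloballyMinimal]
    (hGV : thm14_mainConjecture_transfer_of_torsionIso) (hGr : greenberg_charValue_rankZero)
    (hmod : nonempty_modularParametrizationData) (hmodL : hasEntireLFunction_rat)
    (hGZK : rank_eq_analyticRank_of_analyticRank_le_one)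
    (hW : sha_dvd_analyticSha) (hW20 : lemma20_surjective_threeAdic_of_semistable)
    (hM : mazur_not_dvd_maninConstant_of_odd)
    (hK₁ : ∀ (κ : ZpExtension ℚ 3) (γ : Field.absoluteGaloisGroup ℚ) [NeZero (W₁.conductorNorm ℤ)]
      (f : CuspForm (Gamma0 (W₁.conductorNorm ℤ)) 2), kato_divisibility W₁ 3 (κ := κ) (γ := γ) (f := f))
    (hord₁ : GoodOrd W₁ 3) (hsurj₁ : Surj W₁ 3) (hr0₁ : W₁.analyticRank = 0)
    (hna₁ : ¬ 3 ∣ W₁.reductionPointCount 3)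
    (hsha₁ : ∃ q : ℚ, shaAn W₁ = (q : ℂ) ∧ padicValRat 3 q = 0) (htam₁ : ¬ 3 ∣ W₁.tamagawaProduct)
    (hiso : ∃ e : geomTorsion W₁ ((3 : ℕ) : ℤ) ≃+ geomTorsion W₂ ((3 : ℕ) : ℤ),
      ∀ (σ : Field.absoluteGaloisGroup ℚ) (P : geomTorsion W₁ ((3 : ℕ) : ℤ)), e (σ • P) = σ • e P)
    (h₂ : RowC16 W₂ 3) (hr0 : W₂.analyticRank = 0) : BSDp W₂ 3 :=
  RowC16.bsdp_rankZero_of_mazurMainConjecture hGr hmod hGZK h₂ hr0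
    (mazurMainConjecture_three_of_typeAPartner W₁ W₂ hGV hGr hmodL hGZK hW hW20 hM hK₁ hord₁ hsurj₁
      hr0₁ hna₁ hsha₁ htam₁ hiso h₂.2.1)

end Summit.BirchSwinnertonDyer.Rank1Residual

end
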